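import Literature.NumberTheory.Rogawski1990.ArchOrbFamGExtBoxDescent        -- ★ p851016 (LH3-p04 (g4)) (B-desc) box: `exists_descent_box_chartOrbG`
import Literature.NumberTheory.Rogawski1990.ArchOrbFamGExtWallFactorWick    -- ★ p850964∕(B-wick) (LH1-p03 (g5)): `wallFactorR_eq_two_cos_sub`, `contDiffAt_coe_splitFrozenFactor`, `contDiff_coe_circleExp_comp_of_contDiff`; brings ★ `archERhoG_mul_archRG_add_smul_hcNrm_eq`
import Literature.NumberTheory.Rogawski1990.ArchOrbFamGExtFaceJetBounds     -- ★ p851037∕p851101 (this seat): `exists_nhds_forall_mem_inRegG_iff_of_hcSemireg` (off the wall near `p` ⇒ `RegG`)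
import HarnessLib

/-!
# The `hdesc₁` DRESS: the ★ (B-desc) box descent read in the tokens of ★ FILE 2b — `e^{ρ}·orbFamGExt S = K₁·(2cos ν · Pf(π c) − Ef(π c)) · F(g (π c))(ν)` off the wall
# (Harish-Chandra descent to `U(1,1)_w`; Shelstad 1979 §4 Lemma 4.3; Rogawski 1990 §8.2, §4.12; Varadarajan 1977 I §1.12)

Topic `NumberTheory/Rogawski1990`; namespace `Literature.NumberTheory.Rogawski1990`.  THEOREMS ONLY (no `def`, no instance, no notation, no axiom, no named fact, no `sorry`).  Cell
`pub/hodgecm-mathlib`, crux H413 (`stmt-HodgeConjecture-24833`), F0∕P3c line LH3 (closer stub `stub_N9`, DIRECT ROAD), LETTER L1 clauses (I₁)∕(I₃): the COMMON `hdesc₁` input of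
★ FILE 2b `hasOneSidedJump_iteratedFDeriv_adaptedWord_of_twoChart` ((I₃), F0P3a-p08) and ★ `exists_nhds_bddAbove_norm_iteratedFDeriv_orbFamGExt_of_wallDescent[_oneWall∕']` ((I₁),
`ArchOrbFamGExtFaceJetModel`), DISCHARGED from ★ (B-desc) box `exists_descent_box_chartOrbG` (LH3-p04, p851016) — (I₁) spec-owner LH7-p04 (g4) 2026-09-02T10:45:11Z «(i) the
`hdesc₁` DRESS is yours», seat LH3-p02 (g4).  Count-neutral.

THE MATHEMATICS.  At a semiregular point `p` of the noncompact wall `(w₀, 0, 2)` (`w₀ ∉ S` a split-chart place) the box descent gives `K ≠ 0`, an open `U ∋ p` and ONE jointly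
smooth, uniformly `X`-compactly-supported, TANGENTIAL family `f (c, X)` with `chartOrbG ν′ S a′ c = K · ∫_{U(J)} f(c, Ad_h(P t(c) P⁻¹)) dμ₀` on `U ∩ RegG S`, `t(c) = diag(e^{i c_{w₀0}},
e^{i c_{w₀2}})`.  Write `ν = (c_{w₀0} − c_{w₀2})∕2`, `π c = c − ν·hcNrm` (on the wall), `θ = (π c)_{w₀0}`: then `t(c) = e^{iθ}·(e^{iν}, e^{−iν})` and, the centre being central,
`Ad_h(P t(c) P⁻¹) = e^{iθ} • Ad_h(P t_1(ν) P⁻¹)` (§2), so the integral is the Cayley `U(J)` functional at centre `1` of the member `g (π c) := f(π c, e^{iθ} • ·)` — again jointly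
smooth with one compact support, and `f(c, ·) = f(π c, ·)` (tangential).  Off the wall near `p` the point is `G`-regular (★ `mem_regG_of_offWall`), `orbFamGExt = R′·chartOrbG`
(★ `orbFamGExt_of_mem_regG_of_admissible`), and `e^{ρ}R′(c) = 2 sin ν · R_{π c}(ν)` (★ `archERhoG_mul_archRG_add_smul_hcNrm_eq`) with `R_q(ν) = i(2cos ν − 2cos(q_{w₀0} − q_{w₀1}))·Π(q)`
(★ `wallFactorR_eq_two_cos_sub`); the `2 sin ν` IS the normalisation inside `F`, so
  **`e^{ρ}_S(c) · orbFamGExt ν′ a′ S c = K · ((2cos ν)·Pf(π c) − Ef(π c)) · F (g (π c)) (ν)`**, `Pf = i·Π`, `Ef = 2cos(θ−φ)·Pf`, for EVERY `c ∈ U₁` with `ν ≠ 0`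
— the `hdesc₁` text with `ce := 2cos`, `K₁ := K`, and `Pf, Ef` smooth on `Q = {q | ∀ w′ ∈ S, w′ ≠ w₀ → q w′ 0 ≠ 0}` (§1, the per-factor argument of ★ (R4)).
* §1 `contDiffOn_frozenProd`, `isOpen_setOf_forall_mem_apply_ne_zero`; §2 `coe_conj_cayleyTorus_eq_smul`; §3 HEAD **`exists_wallDescent_dress`**.
HONEST LABEL: pair `(0,2)` and `HcSemireg` base points only (what ★ p851016 descends; general one-wall points wait on (B-desc′), general pairs on (B-rel)); HC_CM is proved only modulo the
7 printed citations (2 remaining: hLiu418 = `stmt-HodgeConjecture-24832`, h413 = `stmt-HodgeConjecture-24833`) until rung 0 closes; this file moves no row of the books.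

## References
* [Shelstad1979] D. Shelstad, *Characters and inner forms of a quasi-split group over ℝ*, Compositio Math. 39 (1979), §4 Lemma 4.3 (p. 25), Prop. 4.5 (p. 26).
* [Rogawski1990] J. D. Rogawski, *Automorphic Representations of Unitary Groups in Three Variables*, Ann. of Math. Stud. 123 (1990), §4.12 Lemma 4.12.1 p. 66, §8.2 pp. 118–124.
* [Varadarajan1977] V. S. Varadarajan, *Harmonic Analysis on Real Reductive Groups*, LNM 576 (1977), Part I §1.12.
-/

set_option autoImplicit false

noncomputable section

open Set Filter Topology Function MeasureTheory NumberField NumberField.InfinitePlace Complex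
open scoped ContDiff MatrixGroups Matrix Classical Real Matrix.Norms.Operator

namespace Literature.NumberTheory.Rogawski1990

open Literature.NumberTheory.Automorphic Literature.NumberTheory.Automorphic.UnitaryGroup Literature.NumberTheory.Automorphic.ArchCartan

/-! ## §1 The frozen root product `Π(q)` of the wall factor is `C^∞` off the split-place loci `x_{w′} = 0` -/

section Frozen

variable {W : Type*} [Fintype W] [DecidableEq W]

/-- **The frozen product `Π(q) = ∏_{w′ ≠ w} (e^{ρ}-factor · root factor at w′)(q)` of ★ `wallFactorR` is `C^∞` on `{q | ∀ w′ ∈ S, w′ ≠ w → q w′ 0 ≠ 0}`** (per factor as in ★ (R4)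
`contDiffOn_wallFactorR_uncurry`: compact-place factors are `cexp` of real-linear forms, split-place factors are smooth off `x_{w′} = 0`, ★ `contDiffAt_coe_splitFrozenFactor`).
[cite: Shelstad1979, Lemma 4.3 (p. 25)] [cite: Rogawski1990, §8.2 pp. 118–124] -/
theorem contDiffOn_frozenProd (S : Finset W) (w : W) :
    ContDiffOn ℝ ∞ (fun q : W → Fin 3 → ℝ =>
      ∏ w' ∈ Finset.univ.erase w,
        ((if w' ∈ S then (1 : ℂ) else (Circle.exp (q w' 0 - q w' 2) : ℂ)) *
          (if w' ∈ S then
              ((|Real.exp (q w' 0) - Real.exp (-q w' 0)| *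
                ‖Complex.exp (q w' 0 + q w' 2 * I) - Complex.exp (q w' 1 * I)‖ * ‖Complex.exp (-q w' 0 + q w' 2 * I) - Complex.exp (q w' 1 * I)‖ : ℝ) : ℂ)
            else (1 - (Circle.exp (q w' 1 - q w' 0) : ℂ)) * (1 - (Circle.exp (q w' 2 - q w' 0) : ℂ)) * (1 - (Circle.exp (q w' 2 - q w' 1) : ℂ)))))
      {q | ∀ w' ∈ S, w' ≠ w → q w' 0 ≠ 0} := by
  have hc : ∀ (w' : W) (l : Fin 3), ContDiff ℝ ∞ fun q : W → Fin 3 → ℝ => q w' l := fun w' l => contDiff_apply_apply (𝕜 := ℝ) (E := ℝ) w' l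
  intro q hq
  refine ContDiffAt.contDiffWithinAt ?_
  refine contDiffAt_prod fun w' hw' => ?_
  have hne : w' ≠ w := Finset.ne_of_mem_erase hw'
  by_cases hS : w' ∈ S
  · simp only [if_pos hS]
    exact contDiffAt_const.mul (contDiffAt_coe_splitFrozenFactor (hc w' 0) (hc w' 2) (hc w' 1) (hq w' hS hne))
  · simp only [if_neg hS]
    exact ((contDiff_coe_circleExp_comp_of_contDiff ((hc w' 0).sub (hc w' 2))).mul
      (((contDiff_const.sub (contDiff_coe_circleExp_comp_of_contDiff ((hc w' 1).sub (hc w' 0)))).mul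
        (contDiff_const.sub (contDiff_coe_circleExp_comp_of_contDiff ((hc w' 2).sub (hc w' 0))))).mul
        (contDiff_const.sub (contDiff_coe_circleExp_comp_of_contDiff ((hc w' 2).sub (hc w' 1)))))).contDiffAt

omit [Fintype W] [DecidableEq W] in
/-- The open carrier is open. [cite: Shelstad1979, §4 p. 22] -/
theorem isOpen_setOf_forall_mem_apply_ne_zero (S : Finset W) (w : W) : IsOpen {q : W → Fin 3 → ℝ | ∀ w' ∈ S, w' ≠ w → q w' 0 ≠ 0} := by
  have h : {q : W → Fin 3 → ℝ | ∀ w' ∈ S, w' ≠ w → q w' 0 ≠ 0} = (fun q : W → Fin 3 → ℝ => (((0 : ℝ), q) : ℝ × (W → Fin 3 → ℝ))) ⁻¹'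
      {q : ℝ × (W → Fin 3 → ℝ) | ∀ w' ∈ S, w' ≠ w → q.2 w' 0 ≠ 0} := by
    ext q; simp only [mem_setOf_eq, mem_preimage]
  rw [h]
  exact (isOpen_setOf_forall_mem_snd_apply_ne_zero S w).preimage (continuous_const.prodMk continuous_id)

end Frozen

/-! ## §2 The Cayley torus arc: centre × symmetric pair, read on the conjugate as a scalar -/

section Torus

variable {J : Matrix (Fin 2) (Fin 2) ℂ} (hJ : J = (StdForm.antidiagonal 2).over ℂ)

include hJ in
/-- **`Ad_h(P·diag(z·v)·P⁻¹) = z • Ad_h(P·diag(v)·P⁻¹)` as matrices** (`z ∈ S¹` a centre): `circleDiagonal` is multiplicative and `diag(z, z) = z·1` is central. [cite: Rogawski1990, §8.2 p. 119] -/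
theorem coe_conj_cayleyTorus_eq_smul (h : ↥(unitaryGroupOfForm (starRingEnd ℂ) J)) (z : Circle) (u v : Fin 2 → Circle) (huv : u = fun i => z * v i) :
    (((h * ⟨Matrix.GeneralLinearGroup.mkOfDetNeZero !![(1 : ℂ), 1; 1, -1] det_cayleyTwo_ne_zero * circleDiagonal 2 u *
            (Matrix.GeneralLinearGroup.mkOfDetNeZero !![(1 : ℂ), 1; 1, -1] det_cayleyTwo_ne_zero)⁻¹, cayley_conj_circleDiagonal_mem_of_eq_over hJ _⟩ * h⁻¹ :
          ↥(unitaryGroupOfForm (starRingEnd ℂ) J)) : GL (Fin 2) ℂ) : Matrix (Fin 2) (Fin 2) ℂ) =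
      (z : ℂ) • (((h * ⟨Matrix.GeneralLinearGroup.mkOfDetNeZero !![(1 : ℂ), 1; 1, -1] det_cayleyTwo_ne_zero * circleDiagonal 2 v *
            (Matrix.GeneralLinearGroup.mkOfDetNeZero !![(1 : ℂ), 1; 1, -1] det_cayleyTwo_ne_zero)⁻¹, cayley_conj_circleDiagonal_mem_of_eq_over hJ _⟩ * h⁻¹ :
          ↥(unitaryGroupOfForm (starRingEnd ℂ) J)) : GL (Fin 2) ℂ) : Matrix (Fin 2) (Fin 2) ℂ) := by
  have hdiag : ((circleDiagonal 2 u : GL (Fin 2) ℂ) : Matrix (Fin 2) (Fin 2) ℂ) = (z : ℂ) • ((circleDiagonal 2 v : GL (Fin 2) ℂ) : Matrix (Fin 2) (Fin 2) ℂ) := by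
    rw [coe_circleDiagonal, coe_circleDiagonal, huv]
    have : (fun i : Fin 2 => ((z * v i : Circle) : ℂ)) = (z : ℂ) • fun i : Fin 2 => ((v i : Circle) : ℂ) := by
      funext i; simp only [Circle.coe_mul, Pi.smul_apply, smul_eq_mul]
    rw [this, Matrix.diagonal_smul]
  simp only [Subgroup.coe_mul, InvMemClass.coe_inv, Units.val_mul, hdiag, Matrix.mul_smul, Matrix.smul_mul]

end Torus

/-! ## §3 THE DRESS: ★ (B-desc) box descent in the tokens of ★ FILE 2b's `hdesc₁` -/

section Dress

variable (L : Type) [Field L] [NumberField L] [IsCMField L] (α : Fin 3 → L)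
  [MeasurableSpace ↥(arch (↥(maximalRealSubfield L)) L (IsCMField.complexConj L) 3 (Matrix.diagonal α))]
  [BorelSpace ↥(arch (↥(maximalRealSubfield L)) L (IsCMField.complexConj L) 3 (Matrix.diagonal α))]
  (ν' : Measure ↥(arch (↥(maximalRealSubfield L)) L (IsCMField.complexConj L) 3 (Matrix.diagonal α))) [ν'.IsHaarMeasure] [ν'.IsMulRightInvariant]

/-- **THE `hdesc₁` DRESS OF THE BOX DESCENT.**  At a semiregular point `p` of the noncompact wall `(w₀, 0, 2)` (`w₀ ∉ S` a split-chart place), ★ (B-desc) box `exists_descent_box_chartOrbG`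
(`chartOrbG = K · ∫_{U(J)} f(c, Ad_h(P t(c) P⁻¹))` on `U ∩ RegG S`) READS, for every `c` near `p` OFF THE WALL (`ν c := (c w₀ 0 − c w₀ 2)∕2 ≠ 0`), as
`e^{ρ}_S(c) · orbFamGExt ν′ a′ S c = K₁ · ((2cos ν c) · Pf (π c) − Ef (π c)) · F (g (π c)) (ν c)` — EXACTLY the `hdesc₁` text of ★ FILE 2b `hasOneSidedJump_iteratedFDeriv_adaptedWord_of_twoChart`
and of ★ `exists_nhds_bddAbove_norm_iteratedFDeriv_orbFamGExt_of_wallDescent[_oneWall]` with `ce := 2cos`, where: `π c := c − ν c • hcNrm w₀ 0 2` (the wall projection), `F` is the Cayley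
`U(J)` functional at centre `1` (the `hF` binder, ★ p850929's token shape), `g q X := f (q, e^{i q_{w₀0}} • X)` (the centre `e^{iθ}` of the arc `t(c) = e^{iθ}·(e^{iν}, e^{−iν})` absorbed into
the jointly smooth, uniformly compactly supported family — §2), `Pf = i·Π`, `Ef = i·2cos(θ−φ)·Π` with `Π` the frozen root product of ★ `wallFactorR` (`e^{ρ}R′(c) = 2 sin ν · R_{π c}(ν)`,
★ `archERhoG_mul_archRG_add_smul_hcNrm_eq` at the base point `π c`, and `R = i(2cos ν − 2cos(θ−φ))Π`, ★ `wallFactorR_eq_two_cos_sub`), both `C^∞` on `Q := {q | ∀ w′ ∈ S, w′ ≠ w₀ → q w′ 0 ≠ 0}`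
(§1); the factor `2 sin ν` of `e^{ρ}R′` IS the one inside `F`, so there is no division and no condition beyond `ν c ≠ 0` (off the wall near `p` the point is `G`-regular, ★ `mem_regG_of_offWall`,
and `orbFamGExt = archRG · chartOrbG` there, ★ `orbFamGExt_of_mem_regG_of_admissible`).
[cite: Shelstad1979, §4 Lemma 4.3 (p. 25)] [cite: Rogawski1990, §8.2 pp. 119–124; §4.12 Lemma 4.12.1 p. 66] [cite: Varadarajan1977, Part I §1.12] -/
theorem exists_wallDescent_dress (hα : ∀ i, α i ≠ 0)
    (hreal : ∀ (w : {w : InfinitePlace L // IsComplex w}) (i : Fin 3), (w.1.embedding (α i)).im = 0)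
    {J : Matrix (Fin 2) (Fin 2) ℂ} (hJ : J = (StdForm.antidiagonal 2).over ℂ)
    [MeasurableSpace ↥(unitaryGroupOfForm (starRingEnd ℂ) J)] [BorelSpace ↥(unitaryGroupOfForm (starRingEnd ℂ) J)]
    [LocallyCompactSpace ↥(unitaryGroupOfForm (starRingEnd ℂ) J)] [SecondCountableTopology ↥(unitaryGroupOfForm (starRingEnd ℂ) J)]
    (μ₀ : Measure ↥(unitaryGroupOfForm (starRingEnd ℂ) J)) [μ₀.IsHaarMeasure] [μ₀.IsMulRightInvariant]
    {S : Finset {w : InfinitePlace L // IsComplex w}} {w₀ : {w : InfinitePlace L // IsComplex w}} {p : {w : InfinitePlace L // IsComplex w} → Fin 3 → ℝ}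
    (hS : ∀ w, w ∈ S → w ∈ splitChartPlaces L α) (hw₀ : w₀ ∉ S) (hwsp : w₀ ∈ splitChartPlaces L α) (hp : HcSemireg S w₀ 0 2 p)
    {a' : ↥(arch (↥(maximalRealSubfield L)) L (IsCMField.complexConj L) 3 (Matrix.diagonal α)) → ℂ} (ha' : ArchSmooth L 3 (Matrix.diagonal α) a')
    (F : (Matrix (Fin 2) (Fin 2) ℂ → ℂ) → ℝ → ℂ)
    (hF : ∀ (g : Matrix (Fin 2) (Fin 2) ℂ → ℂ) (ψ : ℝ), F g ψ = (2 * Real.sin ψ) •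
      ∫ h : ↥(unitaryGroupOfForm (starRingEnd ℂ) J), g (((h * (⟨(Matrix.GeneralLinearGroup.mkOfDetNeZero !![(1 : ℂ), 1; 1, -1] det_cayleyTwo_ne_zero) * circleDiagonal 2 ![1 * Circle.exp ψ, 1 * Circle.exp (-ψ)] * ((Matrix.GeneralLinearGroup.mkOfDetNeZero !![(1 : ℂ), 1; 1, -1] det_cayleyTwo_ne_zero))⁻¹, cayley_conj_circleDiagonal_mem_of_eq_over hJ _⟩ : ↥(unitaryGroupOfForm (starRingEnd ℂ) J)) * h⁻¹ : ↥(unitaryGroupOfForm (starRingEnd ℂ) J)) : GL (Fin 2) ℂ) : Matrix (Fin 2) (Fin 2) ℂ) ∂μ₀) :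
    ∃ (K₁ : ℂ) (U₁ : Set ({w : InfinitePlace L // IsComplex w} → Fin 3 → ℝ)) (g : ({w : InfinitePlace L // IsComplex w} → Fin 3 → ℝ) → Matrix (Fin 2) (Fin 2) ℂ → ℂ)
      (Pf Ef : ({w : InfinitePlace L // IsComplex w} → Fin 3 → ℝ) → ℂ),
      K₁ ≠ 0 ∧ IsOpen U₁ ∧ p ∈ U₁ ∧ ContDiff ℝ ∞ (uncurry g) ∧
      (∃ C : Set (Matrix (Fin 2) (Fin 2) ℂ), IsCompact C ∧ ∀ q X, X ∉ C → g q X = 0) ∧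
      ContDiffOn ℝ ∞ Pf {q | ∀ w' ∈ S, w' ≠ w₀ → q w' 0 ≠ 0} ∧ ContDiffOn ℝ ∞ Ef {q | ∀ w' ∈ S, w' ≠ w₀ → q w' 0 ≠ 0} ∧
      (∀ q, Pf q = I * ∏ w' ∈ Finset.univ.erase w₀,
        ((if w' ∈ S then (1 : ℂ) else (Circle.exp (q w' 0 - q w' 2) : ℂ)) *
          (if w' ∈ S then
              ((|Real.exp (q w' 0) - Real.exp (-q w' 0)| *
                ‖Complex.exp (q w' 0 + q w' 2 * I) - Complex.exp (q w' 1 * I)‖ * ‖Complex.exp (-q w' 0 + q w' 2 * I) - Complex.exp (q w' 1 * I)‖ : ℝ) : ℂ)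
            else (1 - (Circle.exp (q w' 1 - q w' 0) : ℂ)) * (1 - (Circle.exp (q w' 2 - q w' 0) : ℂ)) * (1 - (Circle.exp (q w' 2 - q w' 1) : ℂ))))) ∧
      (∀ q, Ef q = ((2 * Real.cos (q w₀ 0 - q w₀ 1) : ℝ) : ℂ) * Pf q) ∧
      ∀ c ∈ U₁, (c w₀ 0 - c w₀ 2) / 2 ≠ 0 →
        archERhoG S c * orbFamGExt L α ν' a' S c =
          K₁ * (((2 * Real.cos ((c w₀ 0 - c w₀ 2) / 2) : ℝ) : ℂ) * Pf (c - ((c w₀ 0 - c w₀ 2) / 2) • hcNrm w₀ 0 2) - Ef (c - ((c w₀ 0 - c w₀ 2) / 2) • hcNrm w₀ 0 2)) *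
            F (g (c - ((c w₀ 0 - c w₀ 2) / 2) • hcNrm w₀ 0 2)) ((c w₀ 0 - c w₀ 2) / 2) := by
  -- the box descent and the semiregular neighbourhood
  obtain ⟨K, U, f, hK, hUo, hpU, hf, ⟨C, hC, hfC⟩, hft, hdesc⟩ := exists_descent_box_chartOrbG L α (ν' := ν') hα hreal hJ μ₀ hS hw₀ hwsp hp ha'
  obtain ⟨U₀, hU₀o, hpU₀, -, h1, h2, h3, h4⟩ := exists_nhds_hcSemireg hw₀ (show (0 : Fin 3) ≠ 2 by decide) hp
  -- the frozen product and the cofactor pair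
  set Pr : ({w : InfinitePlace L // IsComplex w} → Fin 3 → ℝ) → ℂ := fun q => ∏ w' ∈ Finset.univ.erase w₀,
        ((if w' ∈ S then (1 : ℂ) else (Circle.exp (q w' 0 - q w' 2) : ℂ)) *
          (if w' ∈ S then
              ((|Real.exp (q w' 0) - Real.exp (-q w' 0)| *
                ‖Complex.exp (q w' 0 + q w' 2 * I) - Complex.exp (q w' 1 * I)‖ * ‖Complex.exp (-q w' 0 + q w' 2 * I) - Complex.exp (q w' 1 * I)‖ : ℝ) : ℂ)
            else (1 - (Circle.exp (q w' 1 - q w' 0) : ℂ)) * (1 - (Circle.exp (q w' 2 - q w' 0) : ℂ)) * (1 - (Circle.exp (q w' 2 - q w' 1) : ℂ)))) with hPr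
  have hPrs : ContDiffOn ℝ ∞ Pr {q | ∀ w' ∈ S, w' ≠ w₀ → q w' 0 ≠ 0} := contDiffOn_frozenProd S w₀
  have hcos : ContDiff ℝ ∞ fun q : {w : InfinitePlace L // IsComplex w} → Fin 3 → ℝ => ((2 * Real.cos (q w₀ 0 - q w₀ 1) : ℝ) : ℂ) :=
    Complex.ofRealCLM.contDiff.comp (contDiff_const.mul (Real.contDiff_cos.comp ((contDiff_apply_apply ℝ ℝ w₀ 0).sub (contDiff_apply_apply ℝ ℝ w₀ 1))))
  -- the centred family
  set g : ({w : InfinitePlace L // IsComplex w} → Fin 3 → ℝ) → Matrix (Fin 2) (Fin 2) ℂ → ℂ := fun q X => f (q, ((Circle.exp (q w₀ 0) : Circle) : ℂ) • X) with hg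
  have hθ : ContDiff ℝ ∞ fun q : {w : InfinitePlace L // IsComplex w} → Fin 3 → ℝ => ((Circle.exp (q w₀ 0) : Circle) : ℂ) :=
    contDiff_coe_circleExp_comp_of_contDiff (contDiff_apply_apply ℝ ℝ w₀ 0)
  have hgs : ContDiff ℝ ∞ (uncurry g) := by
    have h : uncurry g = f ∘ fun z : ({w : InfinitePlace L // IsComplex w} → Fin 3 → ℝ) × Matrix (Fin 2) (Fin 2) ℂ => (z.1, ((Circle.exp (z.1 w₀ 0) : Circle) : ℂ) • z.2) := by
      funext z; rfl
    rw [h]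
    exact hf.comp (contDiff_fst.prodMk ((hθ.comp contDiff_fst).smul contDiff_snd))
  have hgC : ∃ C' : Set (Matrix (Fin 2) (Fin 2) ℂ), IsCompact C' ∧ ∀ q X, X ∉ C' → g q X = 0 := by
    obtain ⟨R, hR⟩ := hC.isBounded.subset_closedBall (0 : Matrix (Fin 2) (Fin 2) ℂ)
    refine ⟨Metric.closedBall (0 : Matrix (Fin 2) (Fin 2) ℂ) R, isCompact_closedBall _ _, fun q X hX => ?_⟩
    refine hfC q _ fun hmem => hX ?_
    have h := hR hmem
    rw [Metric.mem_closedBall, dist_zero_right, norm_smul, Circle.norm_coe, one_mul] at h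
    rwa [Metric.mem_closedBall, dist_zero_right]
  refine ⟨K, U ∩ U₀, g, fun q => I * Pr q, fun q => ((2 * Real.cos (q w₀ 0 - q w₀ 1) : ℝ) : ℂ) * (I * Pr q), hK, hUo.inter hU₀o, ⟨hpU, hpU₀⟩, hgs, hgC,
    contDiffOn_const.mul hPrs, hcos.contDiffOn.mul (contDiffOn_const.mul hPrs), fun q => rfl, fun q => rfl, ?_⟩
  -- the identity off the wall
  intro c hc hν
  beta_reduce
  set ν : ℝ := (c w₀ 0 - c w₀ 2) / 2 with hνdef
  set q : {w : InfinitePlace L // IsComplex w} → Fin 3 → ℝ := c - ν • hcNrm w₀ 0 2 with hqdef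
  have hN0 : hcNrm w₀ (0 : Fin 3) 2 w₀ 0 = 1 := by simp [hcNrm]
  have hN1 : hcNrm w₀ (0 : Fin 3) 2 w₀ 1 = 0 := by simp [hcNrm]
  have hN2 : hcNrm w₀ (0 : Fin 3) 2 w₀ 2 = -1 := by simp [hcNrm]
  have hNw : ∀ w, w ≠ w₀ → hcNrm w₀ (0 : Fin 3) 2 w = 0 := fun w hw => by simp [hcNrm, hw]
  have hq0 : q w₀ 0 = c w₀ 0 - ν := by simp [hqdef, hN0]
  have hq1 : q w₀ 1 = c w₀ 1 := by simp [hqdef, hN1]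
  have hq2 : q w₀ 2 = c w₀ 2 + ν := by simp [hqdef, hN2]
  have hqw : ∀ w, w ≠ w₀ → q w = c w := fun w hw => by
    funext l; simp [hqdef, hNw w hw]
  have hq02 : q w₀ 0 = q w₀ 2 := by rw [hq0, hq2, hνdef]; ring
  have hcq : c = q + ν • hcNrm w₀ 0 2 := by rw [hqdef, sub_add_cancel]
  -- off the wall near `p`: `G`-regular, so the extended family is `R′ · chartOrbG`
  have hc02 : c w₀ 0 ≠ c w₀ 2 := fun h0 => hν (by rw [hνdef, h0, sub_self, zero_div])
  have hreg : c ∈ RegG S := mem_regG_of_offWall (show (0 : Fin 3) ≠ 2 by decide) (h1 c hc.2) (h2 c hc.2) (h3 c hc.2) (h4 c hc.2) hc02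
  rw [orbFamGExt_of_mem_regG_of_admissible L α ν' a' S hS hreg, hdesc c ⟨hc.1, hreg⟩, ← mul_assoc]
  -- the wall factor at the base point `q = π c`
  have hρR : archERhoG S c * archRG S c = (2 * Real.sin ν : ℂ) * (I * ((2 * Real.cos ν - 2 * Real.cos (q w₀ 0 - q w₀ 1) : ℝ) : ℂ) * Pr q) := by
    have h := archERhoG_mul_archRG_add_smul_hcNrm_eq S hw₀ hq02 ν
    rw [← hcq] at h
    rw [h, congrFun (wallFactorR_eq_two_cos_sub S w₀ q) ν]
  -- the torus arc: centre `e^{i q_{w₀0}}` × symmetric pair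
  have hvec : (![Circle.exp (c w₀ 0), Circle.exp (c w₀ 2)] : Fin 2 → Circle) = fun i => Circle.exp (q w₀ 0) * (![1 * Circle.exp ν, 1 * Circle.exp (-ν)] : Fin 2 → Circle) i := by
    funext i
    fin_cases i
    · show Circle.exp (c w₀ 0) = Circle.exp (q w₀ 0) * (1 * Circle.exp ν)
      rw [one_mul, ← Circle.exp_add, hq0, sub_add_cancel]
    · show Circle.exp (c w₀ 2) = Circle.exp (q w₀ 0) * (1 * Circle.exp (-ν))
      rw [one_mul, ← Circle.exp_add, hq0]
      congr 1; rw [hνdef]; ring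
  -- the family reads `f (c, ·)` at the base point
  have hfq : ∀ Y, f (c, Y) = f (q, Y) := by
    intro Y
    rw [hft c, hft q]
    congr 2
    funext w
    by_cases hw : w = w₀
    · subst hw; simp [hq1]
    · rw [Function.update_of_ne hw, Function.update_of_ne hw, hqw w hw]
  have hint : (fun h : ↥(unitaryGroupOfForm (starRingEnd ℂ) J) => f (c, (((h * (⟨(Matrix.GeneralLinearGroup.mkOfDetNeZero !![(1 : ℂ), 1; 1, -1] det_cayleyTwo_ne_zero) * circleDiagonal 2 ![Circle.exp (c w₀ 0), Circle.exp (c w₀ 2)] * ((Matrix.GeneralLinearGroup.mkOfDetNeZero !![(1 : ℂ), 1; 1, -1] det_cayleyTwo_ne_zero))⁻¹, cayley_conj_circleDiagonal_mem_of_eq_over hJ _⟩ : ↥(unitaryGroupOfForm (starRingEnd ℂ) J)) * h⁻¹ : ↥(unitaryGroupOfForm (starRingEnd ℂ) J)) : GL (Fin 2) ℂ) : Matrix (Fin 2) (Fin 2) ℂ))) =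
      fun h => g q (((h * (⟨(Matrix.GeneralLinearGroup.mkOfDetNeZero !![(1 : ℂ), 1; 1, -1] det_cayleyTwo_ne_zero) * circleDiagonal 2 ![1 * Circle.exp ν, 1 * Circle.exp (-ν)] * ((Matrix.GeneralLinearGroup.mkOfDetNeZero !![(1 : ℂ), 1; 1, -1] det_cayleyTwo_ne_zero))⁻¹, cayley_conj_circleDiagonal_mem_of_eq_over hJ _⟩ : ↥(unitaryGroupOfForm (starRingEnd ℂ) J)) * h⁻¹ : ↥(unitaryGroupOfForm (starRingEnd ℂ) J)) : GL (Fin 2) ℂ) : Matrix (Fin 2) (Fin 2) ℂ) := by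
    funext h
    rw [coe_conj_cayleyTorus_eq_smul hJ h (Circle.exp (q w₀ 0)) _ _ hvec, hfq]
  rw [hint, hF, hρR, Complex.real_smul]
  push_cast
  ring

end Dress

/-! ## §4 EDITION 2 — THE DRESS OF A (B-desc′) BOX PACKAGE at a NON-GENERIC one-wall base point (CUT 2 of the (I₁) faces; LH3-plan (g4) RULING #18 O-L1c) -/

section DressPackage

variable (L : Type) [Field L] [NumberField L] [IsCMField L] (α : Fin 3 → L)
  [MeasurableSpace ↥(arch (↥(maximalRealSubfield L)) L (IsCMField.complexConj L) 3 (Matrix.diagonal α))]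
  [BorelSpace ↥(arch (↥(maximalRealSubfield L)) L (IsCMField.complexConj L) 3 (Matrix.diagonal α))]
  (ν' : Measure ↥(arch (↥(maximalRealSubfield L)) L (IsCMField.complexConj L) 3 (Matrix.diagonal α))) [ν'.IsHaarMeasure] [ν'.IsMulRightInvariant]

/-- **THE `hdesc₁` DRESS OF A (B-desc′) BOX PACKAGE (EDITION 2, non-generic one-wall base points).**  Let `x` be ANY point and `(K, U, f)` a box-descent package for the EXTENDED family
around `x` in the eight-clause shape of ★ (B-desc′) `exists_descent_box_orbFamGExt_inRegG_of_core[Package]` (LH7-p02 (g4), p851168; its (H-core) input is LH5-p02 (g4)'s):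
`orbFamGExt ν′ a′ S c = Φ₀(c) · K · ∫_{U(J)} f(c, Ad_h(P t(c) P⁻¹)) dμ₀` for every `c ∈ U` OFF THE `w₀`-WALL (`e^{ic_{w₀0}} ≠ e^{ic_{w₀2}}`), `Φ₀` the three signed `w₀`-root
factors, `f` jointly `C^∞`, uniformly compactly supported in the matrix variable and blind to the `w₀`-slots `0, 2` (`hft`).  Then, with NO hypothesis on `x` and no measure-theoretic
input (the identity is rewritten pointwise under the integral sign): for every `c ∈ U` with `sin ν c ≠ 0`, `ν c := (c w₀ 0 − c w₀ 2)∕2` (which forbids `e^{ic_{w₀0}} = e^{ic_{w₀2}}`: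
`e^{2iν} = 1 ⇒ ν ∈ πℤ ⇒ sin ν = 0`),
`e^{ρ}_S(c) · orbFamGExt ν′ a′ S c = K · ((2cos ν c) · Pf (π c) − Ef (π c)) · F (g (π c)) (ν c)` — the `hdesc₁` text of ★ `exists_nhds_bddAbove_norm_iteratedFDeriv_orbFamGExt_of_wallDescent_oneWall`
and of ★ FILE 2b with `ce := 2cos`, `T₁ := {sin ≠ 0}`: `π c := c − ν c • hcNrm w₀ 0 2`, `F` the Cayley `U(J)` functional at centre `1` (`hF`), `g q X := f (q, e^{i q_{w₀0}} • X)` (§2: the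
centre of the arc `t(c) = e^{iθ}·(e^{iν}, e^{−iν})` absorbed), and now GLOBALLY smooth cofactors `Pf = i·E`, `Ef = 2cos(θ − φ)·Pf`, `E(q) := ∏_{w′ ≠ w₀} (e^{ρ}-factor at w′)(q)`
(a product of unit exponentials of real-linear forms): the `w₀`-factor of `e^{ρ}_S` against `Φ₀` is `e^{2iν}·Φ₀ = 2 sin ν · i · (2cos ν − 2cos(θ − φ))` (★ `circleExp_two_mul_mul_one_sub`,
★ `coe_circleExp_mul_one_sub_mul_one_sub_eq_two_cos_sub`), and `2 sin ν` IS the factor inside `F`.  The other places' root factors live inside the package's `f` (they are smooth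
across the compact and real walls met in `U ∩ InRegG`), which is why EDITION 2's cofactors carry no `|e^x − e^{−x}|` and need no carrier `Q`.
[cite: Varadarajan1977, Part I §1.12] [cite: Shelstad1979, §4 Lemma 4.3 (p. 25)] [cite: Rogawski1990, §8.2 pp. 119–124] [cite: Bouaziz1994IntegralesOrbitales, §3.1 (I₁)–(I₂) p. 579] -/
theorem exists_wallDescent_dress_of_boxPackage
    {J : Matrix (Fin 2) (Fin 2) ℂ} (hJ : J = (StdForm.antidiagonal 2).over ℂ) [MeasurableSpace ↥(unitaryGroupOfForm (starRingEnd ℂ) J)] (μ₀ : Measure ↥(unitaryGroupOfForm (starRingEnd ℂ) J))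
    {S : Finset {w : InfinitePlace L // IsComplex w}} {w₀ : {w : InfinitePlace L // IsComplex w}} {x : {w : InfinitePlace L // IsComplex w} → Fin 3 → ℝ} (hw₀ : w₀ ∉ S)
    {a' : ↥(arch (↥(maximalRealSubfield L)) L (IsCMField.complexConj L) 3 (Matrix.diagonal α)) → ℂ}
    {K : ℂ} {U : Set ({w : InfinitePlace L // IsComplex w} → Fin 3 → ℝ)} {f : ({w : InfinitePlace L // IsComplex w} → Fin 3 → ℝ) × Matrix (Fin 2) (Fin 2) ℂ → ℂ}
    (hK : K ≠ 0) (hUo : IsOpen U) (hxU : x ∈ U) (hf : ContDiff ℝ ∞ f)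
    (hfC : ∃ C : Set (Matrix (Fin 2) (Fin 2) ℂ), IsCompact C ∧ ∀ c X, X ∉ C → f (c, X) = 0)
    (hft : ∀ c X, f (c, X) = f (Function.update c w₀ ![0, c w₀ 1, 0], X))
    (hdesc : ∀ c ∈ U, Circle.exp (c w₀ 0) ≠ Circle.exp (c w₀ 2) →
        orbFamGExt L α ν' a' S c =
          (1 - (Circle.exp (c w₀ 1 - c w₀ 0) : ℂ)) * (1 - (Circle.exp (c w₀ 2 - c w₀ 0) : ℂ)) * (1 - (Circle.exp (c w₀ 2 - c w₀ 1) : ℂ)) *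
          (K * ∫ h : ↥(unitaryGroupOfForm (starRingEnd ℂ) J),
            f (c, (((h * ⟨Matrix.GeneralLinearGroup.mkOfDetNeZero !![(1 : ℂ), 1; 1, -1] det_cayleyTwo_ne_zero *
                  circleDiagonal 2 ![Circle.exp (c w₀ 0), Circle.exp (c w₀ 2)] *
                  (Matrix.GeneralLinearGroup.mkOfDetNeZero !![(1 : ℂ), 1; 1, -1] det_cayleyTwo_ne_zero)⁻¹,
                cayley_conj_circleDiagonal_mem_of_eq_over hJ _⟩ * h⁻¹ : ↥(unitaryGroupOfForm (starRingEnd ℂ) J)) : GL (Fin 2) ℂ) : Matrix (Fin 2) (Fin 2) ℂ)) ∂μ₀))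
    (F : (Matrix (Fin 2) (Fin 2) ℂ → ℂ) → ℝ → ℂ)
    (hF : ∀ (g : Matrix (Fin 2) (Fin 2) ℂ → ℂ) (ψ : ℝ), F g ψ = (2 * Real.sin ψ) •
      ∫ h : ↥(unitaryGroupOfForm (starRingEnd ℂ) J), g (((h * (⟨(Matrix.GeneralLinearGroup.mkOfDetNeZero !![(1 : ℂ), 1; 1, -1] det_cayleyTwo_ne_zero) * circleDiagonal 2 ![1 * Circle.exp ψ, 1 * Circle.exp (-ψ)] * ((Matrix.GeneralLinearGroup.mkOfDetNeZero !![(1 : ℂ), 1; 1, -1] det_cayleyTwo_ne_zero))⁻¹, cayley_conj_circleDiagonal_mem_of_eq_over hJ _⟩ : ↥(unitaryGroupOfForm (starRingEnd ℂ) J)) * h⁻¹ : ↥(unitaryGroupOfForm (starRingEnd ℂ) J)) : GL (Fin 2) ℂ) : Matrix (Fin 2) (Fin 2) ℂ) ∂μ₀) :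
    ∃ (K₁ : ℂ) (U₁ : Set ({w : InfinitePlace L // IsComplex w} → Fin 3 → ℝ)) (g : ({w : InfinitePlace L // IsComplex w} → Fin 3 → ℝ) → Matrix (Fin 2) (Fin 2) ℂ → ℂ)
      (Pf Ef : ({w : InfinitePlace L // IsComplex w} → Fin 3 → ℝ) → ℂ),
      K₁ ≠ 0 ∧ IsOpen U₁ ∧ x ∈ U₁ ∧ ContDiff ℝ ∞ (uncurry g) ∧
      (∃ C : Set (Matrix (Fin 2) (Fin 2) ℂ), IsCompact C ∧ ∀ q X, X ∉ C → g q X = 0) ∧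
      ContDiff ℝ ∞ Pf ∧ ContDiff ℝ ∞ Ef ∧
      (∀ q, Pf q = I * ∏ w' ∈ Finset.univ.erase w₀, (if w' ∈ S then (1 : ℂ) else (Circle.exp (q w' 0 - q w' 2) : ℂ))) ∧
      (∀ q, Ef q = ((2 * Real.cos (q w₀ 0 - q w₀ 1) : ℝ) : ℂ) * Pf q) ∧
      ∀ c ∈ U₁, Real.sin ((c w₀ 0 - c w₀ 2) / 2) ≠ 0 →
        archERhoG S c * orbFamGExt L α ν' a' S c =
          K₁ * (((2 * Real.cos ((c w₀ 0 - c w₀ 2) / 2) : ℝ) : ℂ) * Pf (c - ((c w₀ 0 - c w₀ 2) / 2) • hcNrm w₀ 0 2) - Ef (c - ((c w₀ 0 - c w₀ 2) / 2) • hcNrm w₀ 0 2)) *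
            F (g (c - ((c w₀ 0 - c w₀ 2) / 2) • hcNrm w₀ 0 2)) ((c w₀ 0 - c w₀ 2) / 2) := by
  obtain ⟨C, hC, hfC⟩ := hfC
  -- the unit product `E` and the cofactor pair (globally smooth)
  set Pr : ({w : InfinitePlace L // IsComplex w} → Fin 3 → ℝ) → ℂ := fun q => ∏ w' ∈ Finset.univ.erase w₀, (if w' ∈ S then (1 : ℂ) else (Circle.exp (q w' 0 - q w' 2) : ℂ)) with hPr
  have hPrs : ContDiff ℝ ∞ Pr := by
    refine contDiff_prod fun w' _ => ?_
    by_cases hS : w' ∈ S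
    · simp only [if_pos hS]; exact contDiff_const
    · simp only [if_neg hS]
      exact contDiff_coe_circleExp_comp_of_contDiff ((contDiff_apply_apply ℝ ℝ w' 0).sub (contDiff_apply_apply ℝ ℝ w' 2))
  have hcos : ContDiff ℝ ∞ fun q : {w : InfinitePlace L // IsComplex w} → Fin 3 → ℝ => ((2 * Real.cos (q w₀ 0 - q w₀ 1) : ℝ) : ℂ) :=
    Complex.ofRealCLM.contDiff.comp (contDiff_const.mul (Real.contDiff_cos.comp ((contDiff_apply_apply ℝ ℝ w₀ 0).sub (contDiff_apply_apply ℝ ℝ w₀ 1))))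
  -- the centred family
  set g : ({w : InfinitePlace L // IsComplex w} → Fin 3 → ℝ) → Matrix (Fin 2) (Fin 2) ℂ → ℂ := fun q X => f (q, ((Circle.exp (q w₀ 0) : Circle) : ℂ) • X) with hg
  have hθ : ContDiff ℝ ∞ fun q : {w : InfinitePlace L // IsComplex w} → Fin 3 → ℝ => ((Circle.exp (q w₀ 0) : Circle) : ℂ) :=
    contDiff_coe_circleExp_comp_of_contDiff (contDiff_apply_apply ℝ ℝ w₀ 0)
  have hgs : ContDiff ℝ ∞ (uncurry g) := by
    have h : uncurry g = f ∘ fun z : ({w : InfinitePlace L // IsComplex w} → Fin 3 → ℝ) × Matrix (Fin 2) (Fin 2) ℂ => (z.1, ((Circle.exp (z.1 w₀ 0) : Circle) : ℂ) • z.2) := by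
      funext z; rfl
    rw [h]
    exact hf.comp (contDiff_fst.prodMk ((hθ.comp contDiff_fst).smul contDiff_snd))
  have hgC : ∃ C' : Set (Matrix (Fin 2) (Fin 2) ℂ), IsCompact C' ∧ ∀ q X, X ∉ C' → g q X = 0 := by
    obtain ⟨R, hR⟩ := hC.isBounded.subset_closedBall (0 : Matrix (Fin 2) (Fin 2) ℂ)
    refine ⟨Metric.closedBall (0 : Matrix (Fin 2) (Fin 2) ℂ) R, isCompact_closedBall _ _, fun q X hX => ?_⟩
    refine hfC q _ fun hmem => hX ?_
    have h := hR hmem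
    rw [Metric.mem_closedBall, dist_zero_right, norm_smul, Circle.norm_coe, one_mul] at h
    rwa [Metric.mem_closedBall, dist_zero_right]
  refine ⟨K, U, g, fun q => I * Pr q, fun q => ((2 * Real.cos (q w₀ 0 - q w₀ 1) : ℝ) : ℂ) * (I * Pr q), hK, hUo, hxU, hgs, hgC,
    contDiff_const.mul hPrs, hcos.mul (contDiff_const.mul hPrs), fun q => rfl, fun q => rfl, ?_⟩
  -- the identity off the wall
  intro c hc hT
  beta_reduce
  set ν : ℝ := (c w₀ 0 - c w₀ 2) / 2 with hνdef
  set q : {w : InfinitePlace L // IsComplex w} → Fin 3 → ℝ := c - ν • hcNrm w₀ 0 2 with hqdef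
  have hN0 : hcNrm w₀ (0 : Fin 3) 2 w₀ 0 = 1 := by simp [hcNrm]
  have hN1 : hcNrm w₀ (0 : Fin 3) 2 w₀ 1 = 0 := by simp [hcNrm]
  have hN2 : hcNrm w₀ (0 : Fin 3) 2 w₀ 2 = -1 := by simp [hcNrm]
  have hNw : ∀ w, w ≠ w₀ → hcNrm w₀ (0 : Fin 3) 2 w = 0 := fun w hw => by simp [hcNrm, hw]
  have hq0 : q w₀ 0 = c w₀ 0 - ν := by simp [hqdef, hN0]
  have hq1 : q w₀ 1 = c w₀ 1 := by simp [hqdef, hN1]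
  have hq2 : q w₀ 2 = c w₀ 2 + ν := by simp [hqdef, hN2]
  have hqw : ∀ w, w ≠ w₀ → q w = c w := fun w hw => by
    funext l; simp [hqdef, hNw w hw]
  have hc0 : c w₀ 0 = q w₀ 0 + ν := by rw [hq0, sub_add_cancel]
  have hc2 : c w₀ 2 = q w₀ 0 - ν := by rw [hq0, hνdef]; ring
  -- off the wall: `sin ν ≠ 0` forbids `e^{ic₀} = e^{ic₂}`
  have hoff : Circle.exp (c w₀ 0) ≠ Circle.exp (c w₀ 2) := by
    intro h
    have h1 : Circle.exp (c w₀ 0 - c w₀ 2) = 1 := by rw [Circle.exp_sub, h, div_self']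
    obtain ⟨m, hm⟩ := Circle.exp_eq_one.1 h1
    refine hT ?_
    rw [show ν = (m : ℝ) * Real.pi by rw [hνdef, hm]; ring]
    exact Real.sin_int_mul_pi m
  -- `e^{ρ}_S(c) = e^{i(c₀ − c₂)} · E(π c)` and the `w₀`-factor against `Φ₀`
  have hρ : archERhoG S c = (Circle.exp (c w₀ 0 - c w₀ 2) : ℂ) * Pr q := by
    rw [archERhoG, ← Finset.mul_prod_erase Finset.univ _ (Finset.mem_univ w₀), if_neg hw₀, hPr]
    congr 1
    exact Finset.prod_congr rfl fun w' hw' => by rw [hqw w' (Finset.ne_of_mem_erase hw')]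
  have hw0 : (Circle.exp (c w₀ 0 - c w₀ 2) : ℂ) * ((1 - (Circle.exp (c w₀ 1 - c w₀ 0) : ℂ)) * (1 - (Circle.exp (c w₀ 2 - c w₀ 0) : ℂ)) * (1 - (Circle.exp (c w₀ 2 - c w₀ 1) : ℂ))) =
      ((2 * Real.sin ν : ℝ) : ℂ) * (I * (((2 * Real.cos ν : ℝ) : ℂ) - ((2 * Real.cos (q w₀ 0 - q w₀ 1) : ℝ) : ℂ))) := by
    rw [show c w₀ 0 - c w₀ 2 = 2 * ν by rw [hc0, hc2]; ring, show c w₀ 1 - c w₀ 0 = q w₀ 1 - q w₀ 0 - ν by rw [hc0, hq1]; ring,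
      show c w₀ 2 - c w₀ 0 = -(2 * ν) by rw [hc0, hc2]; ring, show c w₀ 2 - c w₀ 1 = q w₀ 0 - ν - q w₀ 1 by rw [hc2, hq1]]
    calc (Circle.exp (2 * ν) : ℂ) * ((1 - (Circle.exp (q w₀ 1 - q w₀ 0 - ν) : ℂ)) * (1 - (Circle.exp (-(2 * ν)) : ℂ)) * (1 - (Circle.exp (q w₀ 0 - ν - q w₀ 1) : ℂ)))
        = ((Circle.exp (2 * ν) : ℂ) * (1 - (Circle.exp (-(2 * ν)) : ℂ))) * ((1 - (Circle.exp (q w₀ 1 - q w₀ 0 - ν) : ℂ)) * (1 - (Circle.exp (q w₀ 0 - ν - q w₀ 1) : ℂ))) := by ring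
      _ = (2 * I * Real.sin ν) * ((Circle.exp ν : ℂ) * ((1 - (Circle.exp (q w₀ 1 - q w₀ 0 - ν) : ℂ)) * (1 - (Circle.exp (q w₀ 0 - ν - q w₀ 1) : ℂ)))) := by
          rw [circleExp_two_mul_mul_one_sub]; ring
      _ = (2 * I * Real.sin ν) * ((2 * Real.cos ν - 2 * Real.cos (q w₀ 0 - q w₀ 1) : ℝ) : ℂ) := by rw [Literature.Analysis.Calculus.coe_circleExp_mul_one_sub_mul_one_sub_eq_two_cos_sub]
      _ = ((2 * Real.sin ν : ℝ) : ℂ) * (I * (((2 * Real.cos ν : ℝ) : ℂ) - ((2 * Real.cos (q w₀ 0 - q w₀ 1) : ℝ) : ℂ))) := by push_cast; ring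
  -- the torus arc: centre `e^{i q_{w₀0}}` × symmetric pair, and the family read at the base point
  have hvec : (![Circle.exp (c w₀ 0), Circle.exp (c w₀ 2)] : Fin 2 → Circle) = fun i => Circle.exp (q w₀ 0) * (![1 * Circle.exp ν, 1 * Circle.exp (-ν)] : Fin 2 → Circle) i := by
    funext i
    fin_cases i
    · show Circle.exp (c w₀ 0) = Circle.exp (q w₀ 0) * (1 * Circle.exp ν)
      rw [one_mul, ← Circle.exp_add, hc0]
    · show Circle.exp (c w₀ 2) = Circle.exp (q w₀ 0) * (1 * Circle.exp (-ν))
      rw [one_mul, ← Circle.exp_add, hc2, sub_eq_add_neg]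
  have hfq : ∀ Y, f (c, Y) = f (q, Y) := by
    intro Y
    rw [hft c, hft q]
    congr 2
    funext w
    by_cases hw : w = w₀
    · subst hw; simp [hq1]
    · rw [Function.update_of_ne hw, Function.update_of_ne hw, hqw w hw]
  have hint : (fun h : ↥(unitaryGroupOfForm (starRingEnd ℂ) J) => f (c, (((h * ⟨Matrix.GeneralLinearGroup.mkOfDetNeZero !![(1 : ℂ), 1; 1, -1] det_cayleyTwo_ne_zero *
                  circleDiagonal 2 ![Circle.exp (c w₀ 0), Circle.exp (c w₀ 2)] *
                  (Matrix.GeneralLinearGroup.mkOfDetNeZero !![(1 : ℂ), 1; 1, -1] det_cayleyTwo_ne_zero)⁻¹,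
                cayley_conj_circleDiagonal_mem_of_eq_over hJ _⟩ * h⁻¹ : ↥(unitaryGroupOfForm (starRingEnd ℂ) J)) : GL (Fin 2) ℂ) : Matrix (Fin 2) (Fin 2) ℂ))) =
      fun h => g q (((h * (⟨(Matrix.GeneralLinearGroup.mkOfDetNeZero !![(1 : ℂ), 1; 1, -1] det_cayleyTwo_ne_zero) * circleDiagonal 2 ![1 * Circle.exp ν, 1 * Circle.exp (-ν)] * ((Matrix.GeneralLinearGroup.mkOfDetNeZero !![(1 : ℂ), 1; 1, -1] det_cayleyTwo_ne_zero))⁻¹, cayley_conj_circleDiagonal_mem_of_eq_over hJ _⟩ : ↥(unitaryGroupOfForm (starRingEnd ℂ) J)) * h⁻¹ : ↥(unitaryGroupOfForm (starRingEnd ℂ) J)) : GL (Fin 2) ℂ) : Matrix (Fin 2) (Fin 2) ℂ) := by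
    funext h
    rw [coe_conj_cayleyTorus_eq_smul hJ h (Circle.exp (q w₀ 0)) _ _ hvec, hfq]
  have hfin : ∀ Z : ℂ, (Circle.exp (c w₀ 0 - c w₀ 2) : ℂ) * Pr q * ((1 - (Circle.exp (c w₀ 1 - c w₀ 0) : ℂ)) * (1 - (Circle.exp (c w₀ 2 - c w₀ 0) : ℂ)) * (1 - (Circle.exp (c w₀ 2 - c w₀ 1) : ℂ)) * (K * Z)) =
      K * (((2 * Real.cos ν : ℝ) : ℂ) * (I * Pr q) - ((2 * Real.cos (q w₀ 0 - q w₀ 1) : ℝ) : ℂ) * (I * Pr q)) * (((2 * Real.sin ν : ℝ) : ℂ) * Z) := fun Z => by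
    linear_combination (Pr q * (K * Z)) * hw0
  rw [hdesc c hc hoff, hint, hF, hρ, Complex.real_smul]
  exact hfin _

end DressPackage

end Literature.NumberTheory.Rogawski1990

end
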